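import Summits.QuantumFields.BalabanUV.T4Continuum.Support.GaugeFieldPerturbation
import Literature.MathematicalPhysics.QuantumFieldTheory.Balaban1983to89.B7Prop1Local
import HarnessLib

/-!
# T⁴ programme, node NE3 — kinematic refinement lemma, leaf R1 (supplier stock): THE FIRST-ORDER PRE-COMPENSATED
# PLAQUETTE LEMMA — `T = e^{−X}·U` has `T(∂p) = e^{−X₁} e^{−Ad_{U₁}X₂} · U(∂p) · e^{Ad_{U₄}X₃} e^{X₄}` EXACTLY, hence
# `‖log T(∂p) − log U(∂p)‖ ≤ 4·(covariant curl of X) + O(‖X‖² + a‖X‖)`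

NE3 formalisation swarm `b2b-balaban-t4-ne3-formalise-*`, LEAF PROVER 09 (unit `b2b-balaban-t4-ne3-formalise-leaf-09`),
SUPPLIER duty (owner's ruling «R0 → owner; leaf-09 → XREAD ∕ supplier», journal 2026-08-20T07:38:51Z) for the R1 rows
S4c (leaf-01: the pre-compensated 1-skeleton datum `precomp L U = expUnit (−X₀ L U) · U`, `Support/SkeletonPrecomp`)
and S4e (leaf-08: the loop-log prediction `Xfirst`), whose composition into the owner's socket
`SmoothRefineOfApprox.ApproxRefine … m/(L^j)³` needs the corner fluxes of `T = e^{−X₀}U` and of `U` to agree to FIRST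
order: `Xfirst(fill T)(Lz,κ) − X₀(U)(z,κ) = ((L−1)/(2L))·Σ_{ν≠κ} ±[log T(∂p_{νκ}(z)) − log U(∂p_{νκ}(z))]`, and a
zeroth-order bound `‖T(∂p) − U(∂p)‖ = O(‖X₀‖) = O(b(L^j)^{−2})` would only give a mismatch `O((L^j)^{−2})`.

## Content (generic: ANY unitary `U`, ANY matrix field `X`; [folklore] normed-algebra bookkeeping; 0 defs)

For `U : ℤ^d → (directions) → U(N)`, `X : ℤ^d → (directions) → M_N(ℂ)` and the configuration
`T := fun z κ => expUnit (−X z κ) * U z κ` (the shape of leaf-01's `SkeletonPrecomp.precomp`, with `X := X0 L U`):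
* §1 `units_mul_exp`, `exp_mul_units_inv` (`u·e^Y = e^{Ad_u Y}·u`, `e^Y·u⁻¹ = u⁻¹·e^{Ad_u Y}`; Mathlib
  `NormedSpace.exp_units_conj`) and **`hol_precomp_plaqWord`** — the EXACT identity
  `T(∂p_{κν}(z)) = e^{−X(z,κ)} · e^{−Ad_{U(z,κ)}X(z+e_κ,ν)} · U(∂p_{κν}(z)) · e^{Ad_{U(z,ν)}X(z+e_ν,κ)} · e^{X(z,ν)}`;
* §2 `norm_exp_sub_one_le_two_mul`, `norm_exp_sub_one_sub_le_sq` (`‖e^Z − 1‖ ≤ 2‖Z‖`, `‖e^Z − 1 − Z‖ ≤ ‖Z‖²` on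
  `‖Z‖ ≤ 1`), `norm_conj_product_sub_le` (the abstract second-order expansion of `A·P·B` around `P`);
* §3 **`norm_hol_precomp_sub_linear_le`**: with `‖X‖ ≤ ξ ≤ 1/2` pointwise and `‖U(∂p) − 1‖ ≤ a`,
  `‖T(∂p) − U(∂p) − U(∂p)·ℓ‖ ≤ 37ξ² + 4aξ`, where the LINEAR TERM
  `ℓ = [Ad_{U(z,ν)}X(z+e_ν,κ) − X(z,κ)] − [Ad_{U(z,κ)}X(z+e_κ,ν) − X(z,ν)]` is the COVARIANT CURL of `X` — a difference of
  two covariant differences; **`norm_hol_precomp_sub_hol_le`**: `‖T(∂p) − U(∂p)‖ ≤ 2ξ′ + 37ξ² + 4aξ` when the covariant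
  differences of `X` are `≤ ξ′`; `smallField_precomp_firstOrder`;
* §4 **`norm_flux_precomp_sub_flux_le`**: `‖log T(∂p_{κν}) − log U(∂p_{κν})‖ ≤ 2(2ξ′ + 37ξ² + 4aξ)` once `a ≤ 1/4` and
  `2ξ′ + 37ξ² + 4aξ ≤ 1/4` (the tree's Lipschitz bound `FederbushMean.norm_mlog_sub_mlog_le` on the ball of radius `1/2`).
READING for the crew (not formalised here; leaf-01's vocabulary, file `SkeletonPrecomp` p211335): `X = X0 L U` has
`ξ = (d−1)a` (`norm_X0_le`) and covariant differences `ξ′ ≤ (d−1)·g` from a pointwise covariant flux-gradient bound `g` of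
`U` — so `‖F^T − F^U‖ ≤ 4(d−1)g + O(d²a²)`: first order in the gradient, second order in the field, as the socket needs.

HONEST FRAMING.  Elementary; no printed sentence is a hypothesis; `hol`/`plaqWord`/`expUnit`/`Ad`/`SmallField`/
`IsUnitaryCfg` imported BY NAME, nothing restated; no `def … : Prop` fact, no definition at all; no `sorry`; axioms ⊆
{propext, Classical.choice, Quot.sound}.  NE3 NOT proved; `SmoothRefine`/`ApproxRefine` NOT proved; spine 0/9; the
cell's conditionals (`BetaPertH`, (B), G-an2-4) occur nowhere here; finite T⁴ rung (B)+1 — NOT infinite volume, NOT a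
mass gap, NOT the Clay problem.  HONEST DEPENDENCY (cell page 1): continuum YM on T⁴ ⇐ BetaPertH ∧ nine spine estimates
(0/9 proved); BetaPertH ⇐ (D1) ∧ (D4) ∧ CAP+tail; G-an2-4 gates asym, D1 and NE2/3/4.  PLACEMENT (human rule
2026-08-19): cell work under `Summits/QuantumFields/BalabanUV/`; imports tree modules only (`Support.GaugeFieldPerturbation`
for the unitary/`Ad` tools and `mlog` Lipschitz import chain, `B7Prop1Local` for `hol_plaqWord_eq`); moves nothing.
-/

set_option autoImplicit false

open scoped BigOperators Matrix Matrix.Norms.L2Operator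
open NormedSpace

namespace Summit.QuantumFields.BalabanUV.T4Continuum.PrecompensatedPlaquette

open Literature.MathematicalPhysics.QuantumFieldTheory.Balaban1983to89
open B7Prop1Explicit B7Prop2Explicit B7Prop1Local MatrixLog UnitaryModel
open T4AveragingDeficitWall hiding Site Plane Plaq Bond
open AveragingDeficitTransport (norm_Ad_of_unitary mem_U1_of_unitary)
open FederbushMean (norm_mlog_sub_mlog_le)

noncomputable section

variable {d : ℕ} {n : Type*} [Fintype n] [DecidableEq n]

/-! ## §1 The exact conjugation identity -/

/-- `u · e^Y = e^{Ad_u Y} · u` for a unit `u` (`Ad_u Y = u Y u⁻¹`; Mathlib `exp_units_conj`). [folklore] -/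
theorem units_mul_exp (u : (Matrix n n ℂ)ˣ) (Y : Matrix n n ℂ) :
    (u : Matrix n n ℂ) * exp Y = exp (Ad u Y) * (u : Matrix n n ℂ) := by
  have h := Matrix.exp_units_conj u Y
  unfold Ad
  rw [h, Units.inv_mul_cancel_right]

/-- `e^Y · u⁻¹ = u⁻¹ · e^{Ad_u Y}` for a unit `u`. [folklore] -/
theorem exp_mul_units_inv (u : (Matrix n n ℂ)ˣ) (Y : Matrix n n ℂ) :
    exp Y * ((u⁻¹ : (Matrix n n ℂ)ˣ) : Matrix n n ℂ) = ((u⁻¹ : (Matrix n n ℂ)ˣ) : Matrix n n ℂ) * exp (Ad u Y) := by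
  have h := Matrix.exp_units_conj u Y
  unfold Ad
  rw [h, ← mul_assoc, ← mul_assoc, Units.inv_mul, one_mul]

/-- `Ad_u (−Y) = −Ad_u Y`. [folklore] -/
theorem Ad_neg (u : (Matrix n n ℂ)ˣ) (Y : Matrix n n ℂ) : Ad u (-Y) = -Ad u Y := by
  unfold Ad; rw [mul_neg, neg_mul]

/-- **THE PRE-COMPENSATED PLAQUETTE, EXACTLY**: for `T(z,κ) = e^{−X(z,κ)}·U(z,κ)`,
`T(∂p_{κν}(z)) = e^{−X(z,κ)} · e^{−Ad_{U(z,κ)}X(z+e_κ,ν)} · U(∂p_{κν}(z)) · e^{Ad_{U(z,ν)}X(z+e_ν,κ)} · e^{X(z,ν)}` — the two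
inner exponentials are moved past `U(z,κ)` and `U(z,ν)⁻¹` by conjugation, after which the four bond variables of `U`
stand together as the plaquette of `U`. [folklore] -/
theorem hol_precomp_plaqWord (U : B7Prop1Explicit.Site d → Fin d → (Matrix n n ℂ)ˣ)
    (X : B7Prop1Explicit.Site d → Fin d → Matrix n n ℂ) (z : B7Prop1Explicit.Site d) (κ ν : Fin d) :
    ((hol (fun y μ => expUnit (-(X y μ)) * U y μ) z (plaqWord κ ν) : (Matrix n n ℂ)ˣ) : Matrix n n ℂ)
      = exp (-(X z κ)) * exp (-(Ad (U z κ) (X (z + e κ) ν)))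
        * ((hol U z (plaqWord κ ν) : (Matrix n n ℂ)ˣ) : Matrix n n ℂ)
        * exp (Ad (U z ν) (X (z + e ν) κ)) * exp (X z ν) := by
  rw [hol_plaqWord_eq, hol_plaqWord_eq]
  simp only [Units.val_mul, mul_inv_rev, val_expUnit, val_inv_expUnit, neg_neg]
  have h1 : ∀ M : Matrix n n ℂ, ((U z κ : (Matrix n n ℂ)ˣ) : Matrix n n ℂ) * (exp (-(X (z + e κ) ν)) * M)
      = exp (-(Ad (U z κ) (X (z + e κ) ν))) * (((U z κ : (Matrix n n ℂ)ˣ) : Matrix n n ℂ) * M) := by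
    intro M
    rw [← mul_assoc, units_mul_exp, Ad_neg, mul_assoc]
  have h2 : ∀ M : Matrix n n ℂ, exp (X (z + e ν) κ) * ((((U z ν)⁻¹ : (Matrix n n ℂ)ˣ) : Matrix n n ℂ) * M)
      = (((U z ν)⁻¹ : (Matrix n n ℂ)ˣ) : Matrix n n ℂ) * (exp (Ad (U z ν) (X (z + e ν) κ)) * M) := by
    intro M
    rw [← mul_assoc, exp_mul_units_inv, mul_assoc]
  simp only [mul_assoc]
  rw [h1, h2]

/-! ## §2 Scalar and abstract second-order bounds -/

/-- `‖e^Z − 1‖ ≤ 2‖Z‖` for `‖Z‖ ≤ 1`. [folklore] -/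
theorem norm_exp_sub_one_le_two_mul {Z : Matrix n n ℂ} (hZ : ‖Z‖ ≤ 1) : ‖exp Z - 1‖ ≤ 2 * ‖Z‖ := by
  have h1 := (norm_exp_sub_one_le_of_norm_le (le_refl ‖Z‖)).1
  have h2 : Real.exp ‖Z‖ - 1 ≤ 2 * ‖Z‖ := by
    have := Real.abs_exp_sub_one_le (x := ‖Z‖) (by rwa [abs_of_nonneg (norm_nonneg _)])
    rw [abs_of_nonneg (norm_nonneg _)] at this
    exact (le_abs_self _).trans this
  exact h1.trans h2

/-- `‖e^Z − 1 − Z‖ ≤ ‖Z‖²` for `‖Z‖ ≤ 1` (the tree's `expRem` bound). [folklore] -/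
theorem norm_exp_sub_one_sub_le_sq {Z : Matrix n n ℂ} (hZ : ‖Z‖ ≤ 1) : ‖exp Z - 1 - Z‖ ≤ ‖Z‖ ^ 2 :=
  (norm_exp_sub_one_le_of_norm_le (le_refl ‖Z‖)).2.trans (expRem_le_sq (norm_nonneg _) hZ)

/-- The two-factor exponential prefix `A = e^{Z₁}e^{Z₂}`: `‖A − 1 − (Z₁ + Z₂)‖ ≤ 6ξ²` and `‖A − 1‖ ≤ 5ξ` for
`‖Z₁‖, ‖Z₂‖ ≤ ξ ≤ 1/2`. [folklore] -/
theorem norm_exp_mul_exp_sub_le {Z₁ Z₂ : Matrix n n ℂ} {ξ : ℝ} (h₁ : ‖Z₁‖ ≤ ξ) (h₂ : ‖Z₂‖ ≤ ξ) (hξ : ξ ≤ 1 / 2) :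
    ‖exp Z₁ * exp Z₂ - 1 - (Z₁ + Z₂)‖ ≤ 6 * ξ ^ 2 ∧ ‖exp Z₁ * exp Z₂ - 1‖ ≤ 5 * ξ := by
  have hξ0 : 0 ≤ ξ := (norm_nonneg _).trans h₁
  have hZ1 : ‖Z₁‖ ≤ 1 := h₁.trans (by linarith)
  have hZ2 : ‖Z₂‖ ≤ 1 := h₂.trans (by linarith)
  have e1 := norm_exp_sub_one_le_two_mul hZ1
  have e2 := norm_exp_sub_one_le_two_mul hZ2
  have r1 := norm_exp_sub_one_sub_le_sq hZ1
  have r2 := norm_exp_sub_one_sub_le_sq hZ2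
  have hmain : ‖exp Z₁ * exp Z₂ - 1 - (Z₁ + Z₂)‖ ≤ 6 * ξ ^ 2 := by
    calc ‖exp Z₁ * exp Z₂ - 1 - (Z₁ + Z₂)‖
        ≤ ‖exp Z₁ - 1‖ * ‖exp Z₂ - 1‖ + ‖exp Z₁ - 1 - Z₁‖ + ‖exp Z₂ - 1 - Z₂‖ := norm_mul_sub_one_sub_le _ _ _ _
      _ ≤ (2 * ξ) * (2 * ξ) + ξ ^ 2 + ξ ^ 2 := by
          gcongr
          · exact e1.trans (by linarith)
          · exact e2.trans (by linarith)
          · exact r1.trans (pow_le_pow_left₀ (norm_nonneg _) h₁ 2)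
          · exact r2.trans (pow_le_pow_left₀ (norm_nonneg _) h₂ 2)
      _ = 6 * ξ ^ 2 := by ring
  refine ⟨hmain, ?_⟩
  have hsq : ξ ^ 2 ≤ ξ * (1 / 2) := by rw [sq]; exact mul_le_mul_of_nonneg_left hξ hξ0
  have hsplit : exp Z₁ * exp Z₂ - 1 = (exp Z₁ * exp Z₂ - 1 - (Z₁ + Z₂)) + (Z₁ + Z₂) := by abel
  calc ‖exp Z₁ * exp Z₂ - 1‖ = ‖(exp Z₁ * exp Z₂ - 1 - (Z₁ + Z₂)) + (Z₁ + Z₂)‖ := by rw [← hsplit]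
    _ ≤ ‖exp Z₁ * exp Z₂ - 1 - (Z₁ + Z₂)‖ + ‖Z₁ + Z₂‖ := norm_add_le _ _
    _ ≤ 6 * ξ ^ 2 + (ξ + ξ) := add_le_add hmain ((norm_add_le _ _).trans (add_le_add h₁ h₂))
    _ ≤ 6 * (ξ * (1 / 2)) + (ξ + ξ) := by linarith
    _ = 5 * ξ := by ring

/-- The abstract second-order expansion of a conjugated product around its middle factor:
`APB − P − P(α + β) = (A − 1 − α)P + P(B − 1 − β) + (A − 1)P(B − 1) + (α(P − 1) − (P − 1)α)`, hence the norm bound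
with `‖P‖ ≤ 1`. [folklore] -/
theorem norm_conj_product_sub_le (A P B α β : Matrix n n ℂ) (hP : ‖P‖ ≤ 1) :
    ‖A * P * B - P - P * (α + β)‖
      ≤ ‖A - 1 - α‖ + ‖B - 1 - β‖ + ‖A - 1‖ * ‖B - 1‖ + 2 * ‖α‖ * ‖P - 1‖ := by
  have e1 : A * P * B - P - P * (α + β)
      = (A - 1 - α) * P + P * (B - 1 - β) + (A - 1) * P * (B - 1) + (α * (P - 1) - (P - 1) * α) := by
    simp only [mul_sub, sub_mul, mul_add, mul_one, one_mul, mul_assoc]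
    abel
  rw [e1]
  have n1 : ‖(A - 1 - α) * P‖ ≤ ‖A - 1 - α‖ :=
    (norm_mul_le _ _).trans (mul_le_of_le_one_right (norm_nonneg _) hP)
  have n2 : ‖P * (B - 1 - β)‖ ≤ ‖B - 1 - β‖ :=
    (norm_mul_le _ _).trans (mul_le_of_le_one_left (norm_nonneg _) hP)
  have n3 : ‖(A - 1) * P * (B - 1)‖ ≤ ‖A - 1‖ * ‖B - 1‖ := by
    calc _ ≤ ‖(A - 1) * P‖ * ‖B - 1‖ := norm_mul_le _ _
      _ ≤ ‖A - 1‖ * ‖B - 1‖ :=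
          mul_le_mul_of_nonneg_right ((norm_mul_le _ _).trans (mul_le_of_le_one_right (norm_nonneg _) hP))
            (norm_nonneg _)
  have n4 : ‖α * (P - 1) - (P - 1) * α‖ ≤ 2 * ‖α‖ * ‖P - 1‖ := by
    calc _ ≤ ‖α * (P - 1)‖ + ‖(P - 1) * α‖ := norm_sub_le _ _
      _ ≤ ‖α‖ * ‖P - 1‖ + ‖P - 1‖ * ‖α‖ := add_le_add (norm_mul_le _ _) (norm_mul_le _ _)
      _ = 2 * ‖α‖ * ‖P - 1‖ := by ring
  calc _ ≤ ‖(A - 1 - α) * P + P * (B - 1 - β) + (A - 1) * P * (B - 1)‖ + ‖α * (P - 1) - (P - 1) * α‖ :=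
        norm_add_le _ _
    _ ≤ (‖(A - 1 - α) * P‖ + ‖P * (B - 1 - β)‖ + ‖(A - 1) * P * (B - 1)‖) + ‖α * (P - 1) - (P - 1) * α‖ := by
        gcongr; exact (norm_add_le _ _).trans (add_le_add (norm_add_le _ _) le_rfl)
    _ ≤ _ := by linarith

/-! ## §3 The first-order expansion of the pre-compensated plaquette -/

/-- **FIRST-ORDER EXPANSION, ABSTRACT FORM**: for matrices with `‖X₁‖, ‖Y₂‖, ‖Y₃‖, ‖X₄‖ ≤ ξ ≤ 1/2`, `‖P‖ ≤ 1`,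
`‖P − 1‖ ≤ a`:  `‖e^{−X₁}e^{−Y₂}·P·e^{Y₃}e^{X₄} − P − P·((Y₃ − X₁) − (Y₂ − X₄))‖ ≤ 37ξ² + 4aξ`. [folklore] -/
theorem norm_expConj_sub_linear_le {X₁ Y₂ Y₃ X₄ P : Matrix n n ℂ} {ξ a : ℝ} (hξ : ξ ≤ 1 / 2) (h1 : ‖X₁‖ ≤ ξ)
    (h2 : ‖Y₂‖ ≤ ξ) (h3 : ‖Y₃‖ ≤ ξ) (h4 : ‖X₄‖ ≤ ξ) (hPn : ‖P‖ ≤ 1) (hP : ‖P - 1‖ ≤ a) :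
    ‖exp (-X₁) * exp (-Y₂) * P * exp Y₃ * exp X₄ - P - P * ((Y₃ - X₁) - (Y₂ - X₄))‖ ≤ 37 * ξ ^ 2 + 4 * a * ξ := by
  have hgrp : exp (-X₁) * exp (-Y₂) * P * exp Y₃ * exp X₄ = (exp (-X₁) * exp (-Y₂)) * P * (exp Y₃ * exp X₄) := by
    simp only [mul_assoc]
  have hlin : (Y₃ - X₁) - (Y₂ - X₄) = (-X₁ + -Y₂) + (Y₃ + X₄) := by abel
  rw [hgrp, hlin]
  have hA := norm_exp_mul_exp_sub_le (Z₁ := -X₁) (Z₂ := -Y₂) (ξ := ξ) (by rwa [norm_neg]) (by rwa [norm_neg]) hξ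
  have hB := norm_exp_mul_exp_sub_le (Z₁ := Y₃) (Z₂ := X₄) (ξ := ξ) h3 h4 hξ
  have hα : ‖-X₁ + -Y₂‖ ≤ 2 * ξ := (norm_add_le _ _).trans (by rw [norm_neg, norm_neg]; linarith)
  have hξ0 : 0 ≤ ξ := (norm_nonneg _).trans h1
  have ha0 : 0 ≤ a := (norm_nonneg _).trans hP
  calc _ ≤ ‖exp (-X₁) * exp (-Y₂) - 1 - (-X₁ + -Y₂)‖ + ‖exp Y₃ * exp X₄ - 1 - (Y₃ + X₄)‖
        + ‖exp (-X₁) * exp (-Y₂) - 1‖ * ‖exp Y₃ * exp X₄ - 1‖ + 2 * ‖-X₁ + -Y₂‖ * ‖P - 1‖ :=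
        norm_conj_product_sub_le _ _ _ _ _ hPn
    _ ≤ 6 * ξ ^ 2 + 6 * ξ ^ 2 + (5 * ξ) * (5 * ξ) + 2 * (2 * ξ) * a := by
        gcongr
        · exact hA.1
        · exact hB.1
        · exact hA.2
        · exact hB.2
    _ = 37 * ξ ^ 2 + 4 * a * ξ := by ring

/-- **FIRST-ORDER EXPANSION**: for unitary `U` with `‖U(∂p_{κν}(z)) − 1‖ ≤ a` and `‖X‖ ≤ ξ ≤ 1/2` at the four bonds,
`‖T(∂p_{κν}) − U(∂p_{κν}) − U(∂p_{κν})·ℓ‖ ≤ 37ξ² + 4aξ` with the COVARIANT CURL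
`ℓ = [Ad_{U(z,ν)}X(z+e_ν,κ) − X(z,κ)] − [Ad_{U(z,κ)}X(z+e_κ,ν) − X(z,ν)]`. [folklore] -/
theorem norm_hol_precomp_sub_linear_le [Nonempty n] {U : B7Prop1Explicit.Site d → Fin d → (Matrix n n ℂ)ˣ}
    (hU : IsUnitaryCfg U) (X : B7Prop1Explicit.Site d → Fin d → Matrix n n ℂ) (z : B7Prop1Explicit.Site d) (κ ν : Fin d)
    {ξ a : ℝ} (hξ : ξ ≤ 1 / 2) (h1 : ‖X z κ‖ ≤ ξ) (h2 : ‖X (z + e κ) ν‖ ≤ ξ) (h3 : ‖X (z + e ν) κ‖ ≤ ξ)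
    (h4 : ‖X z ν‖ ≤ ξ) (hP : ‖((hol U z (plaqWord κ ν) : (Matrix n n ℂ)ˣ) : Matrix n n ℂ) - 1‖ ≤ a) :
    ‖((hol (fun y μ => expUnit (-(X y μ)) * U y μ) z (plaqWord κ ν) : (Matrix n n ℂ)ˣ) : Matrix n n ℂ)
        - ((hol U z (plaqWord κ ν) : (Matrix n n ℂ)ˣ) : Matrix n n ℂ)
        - ((hol U z (plaqWord κ ν) : (Matrix n n ℂ)ˣ) : Matrix n n ℂ)
          * ((Ad (U z ν) (X (z + e ν) κ) - X z κ) - (Ad (U z κ) (X (z + e κ) ν) - X z ν))‖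
      ≤ 37 * ξ ^ 2 + 4 * a * ξ := by
  rw [hol_precomp_plaqWord]
  have hPn : ‖((hol U z (plaqWord κ ν) : (Matrix n n ℂ)ˣ) : Matrix n n ℂ)‖ ≤ 1 :=
    (mem_U1.mp (mem_U1_of_unitary (hol_mem_of hU z (plaqWord κ ν)))).1
  have hY2 : ‖Ad (U z κ) (X (z + e κ) ν)‖ ≤ ξ := by rw [norm_Ad_of_unitary (hU z κ)]; exact h2
  have hY3 : ‖Ad (U z ν) (X (z + e ν) κ)‖ ≤ ξ := by rw [norm_Ad_of_unitary (hU z ν)]; exact h3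
  exact norm_expConj_sub_linear_le hξ h1 hY2 hY3 h4 hPn hP

/-- **THE PRE-COMPENSATED PLAQUETTE IS WITHIN FIRST ORDER OF THE ORIGINAL ONE**: if moreover the two covariant
differences of `X` across the plaquette are `≤ ξ′`, then `‖T(∂p_{κν}) − U(∂p_{κν})‖ ≤ 2ξ′ + 37ξ² + 4aξ`. [folklore] -/
theorem norm_hol_precomp_sub_hol_le [Nonempty n] {U : B7Prop1Explicit.Site d → Fin d → (Matrix n n ℂ)ˣ}
    (hU : IsUnitaryCfg U) (X : B7Prop1Explicit.Site d → Fin d → Matrix n n ℂ) (z : B7Prop1Explicit.Site d) (κ ν : Fin d)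
    {ξ ξ' a : ℝ} (hξ : ξ ≤ 1 / 2) (h1 : ‖X z κ‖ ≤ ξ) (h2 : ‖X (z + e κ) ν‖ ≤ ξ) (h3 : ‖X (z + e ν) κ‖ ≤ ξ)
    (h4 : ‖X z ν‖ ≤ ξ) (hP : ‖((hol U z (plaqWord κ ν) : (Matrix n n ℂ)ˣ) : Matrix n n ℂ) - 1‖ ≤ a)
    (hc1 : ‖Ad (U z ν) (X (z + e ν) κ) - X z κ‖ ≤ ξ') (hc2 : ‖Ad (U z κ) (X (z + e κ) ν) - X z ν‖ ≤ ξ') :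
    ‖((hol (fun y μ => expUnit (-(X y μ)) * U y μ) z (plaqWord κ ν) : (Matrix n n ℂ)ˣ) : Matrix n n ℂ)
        - ((hol U z (plaqWord κ ν) : (Matrix n n ℂ)ˣ) : Matrix n n ℂ)‖ ≤ 2 * ξ' + 37 * ξ ^ 2 + 4 * a * ξ := by
  have hmain := norm_hol_precomp_sub_linear_le hU X z κ ν hξ h1 h2 h3 h4 hP
  set E := ((hol (fun y μ => expUnit (-(X y μ)) * U y μ) z (plaqWord κ ν) : (Matrix n n ℂ)ˣ) : Matrix n n ℂ)
  set P := ((hol U z (plaqWord κ ν) : (Matrix n n ℂ)ˣ) : Matrix n n ℂ)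
  set ℓ := (Ad (U z ν) (X (z + e ν) κ) - X z κ) - (Ad (U z κ) (X (z + e κ) ν) - X z ν)
  have hPn : ‖P‖ ≤ 1 := (mem_U1.mp (mem_U1_of_unitary (hol_mem_of hU z (plaqWord κ ν)))).1
  have hℓ : ‖ℓ‖ ≤ 2 * ξ' := (norm_sub_le _ _).trans (by linarith)
  have hPℓ : ‖P * ℓ‖ ≤ 2 * ξ' := (norm_mul_le _ _).trans
    ((mul_le_of_le_one_left (norm_nonneg _) hPn).trans hℓ)
  calc ‖E - P‖ = ‖(E - P - P * ℓ) + P * ℓ‖ := by rw [sub_add_cancel]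
    _ ≤ ‖E - P - P * ℓ‖ + ‖P * ℓ‖ := norm_add_le _ _
    _ ≤ (37 * ξ ^ 2 + 4 * a * ξ) + 2 * ξ' := add_le_add hmain hPℓ
    _ = 2 * ξ' + 37 * ξ ^ 2 + 4 * a * ξ := by ring

/-- First-order small-field transport: under uniform bounds (`‖X‖ ≤ ξ ≤ 1/2` everywhere, covariant differences `≤ ξ′`
for every ordered pair of distinct directions, `SmallField U a`), `SmallField T (a + 2ξ′ + 37ξ² + 4aξ)`. [folklore] -/
theorem smallField_precomp_firstOrder [Nonempty n] {U : B7Prop1Explicit.Site d → Fin d → (Matrix n n ℂ)ˣ}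
    (hU : IsUnitaryCfg U) (X : B7Prop1Explicit.Site d → Fin d → Matrix n n ℂ) {ξ ξ' a : ℝ} (hξ : ξ ≤ 1 / 2)
    (hX : ∀ (y : B7Prop1Explicit.Site d) (μ : Fin d), ‖X y μ‖ ≤ ξ)
    (hcov : ∀ (y : B7Prop1Explicit.Site d) (κ ν : Fin d), κ ≠ ν → ‖Ad (U y ν) (X (y + e ν) κ) - X y κ‖ ≤ ξ')
    (hS : SmallField U a) :
    SmallField (fun y μ => expUnit (-(X y μ)) * U y μ) (a + 2 * ξ' + 37 * ξ ^ 2 + 4 * a * ξ) := by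
  intro z κ ν hκν
  have hP := hS z κ ν hκν
  have h := norm_hol_precomp_sub_hol_le hU X z κ ν hξ (hX _ _) (hX _ _) (hX _ _) (hX _ _) hP
    (hcov z κ ν hκν) (hcov z ν κ (Ne.symm hκν))
  calc _ ≤ ‖((hol (fun y μ => expUnit (-(X y μ)) * U y μ) z (plaqWord κ ν) : (Matrix n n ℂ)ˣ) : Matrix n n ℂ)
          - ((hol U z (plaqWord κ ν) : (Matrix n n ℂ)ˣ) : Matrix n n ℂ)‖
        + ‖((hol U z (plaqWord κ ν) : (Matrix n n ℂ)ˣ) : Matrix n n ℂ) - 1‖ := norm_sub_le_norm_sub_add_norm_sub _ _ _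
    _ ≤ (2 * ξ' + 37 * ξ ^ 2 + 4 * a * ξ) + a := add_le_add h hP
    _ = a + 2 * ξ' + 37 * ξ ^ 2 + 4 * a * ξ := by ring

/-! ## §4 The fluxes agree to first order -/

/-- **THE FLUXES OF `T = e^{−X}U` AND OF `U` AGREE TO FIRST ORDER**: with the hypotheses of
`norm_hol_precomp_sub_hol_le`, `a ≤ 1/4` and `2ξ′ + 37ξ² + 4aξ ≤ 1/4` (so that both plaquette variables lie in the ball
of radius `1/2` on which `log` is `2`-Lipschitz), `‖log T(∂p_{κν}) − log U(∂p_{κν})‖ ≤ 2·(2ξ′ + 37ξ² + 4aξ)` — first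
order in the covariant differences of `X`, second order in `‖X‖` and in `a·‖X‖`. [folklore] -/
theorem norm_flux_precomp_sub_flux_le [Nonempty n] {U : B7Prop1Explicit.Site d → Fin d → (Matrix n n ℂ)ˣ}
    (hU : IsUnitaryCfg U) (X : B7Prop1Explicit.Site d → Fin d → Matrix n n ℂ) (z : B7Prop1Explicit.Site d) (κ ν : Fin d)
    {ξ ξ' a : ℝ} (hξ : ξ ≤ 1 / 2) (h1 : ‖X z κ‖ ≤ ξ) (h2 : ‖X (z + e κ) ν‖ ≤ ξ) (h3 : ‖X (z + e ν) κ‖ ≤ ξ)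
    (h4 : ‖X z ν‖ ≤ ξ) (hP : ‖((hol U z (plaqWord κ ν) : (Matrix n n ℂ)ˣ) : Matrix n n ℂ) - 1‖ ≤ a)
    (hc1 : ‖Ad (U z ν) (X (z + e ν) κ) - X z κ‖ ≤ ξ') (hc2 : ‖Ad (U z κ) (X (z + e κ) ν) - X z ν‖ ≤ ξ')
    (ha : a ≤ 1 / 4) (hsum : 2 * ξ' + 37 * ξ ^ 2 + 4 * a * ξ ≤ 1 / 4) :
    ‖mlog ((hol (fun y μ => expUnit (-(X y μ)) * U y μ) z (plaqWord κ ν) : (Matrix n n ℂ)ˣ) : Matrix n n ℂ)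
        - mlog ((hol U z (plaqWord κ ν) : (Matrix n n ℂ)ˣ) : Matrix n n ℂ)‖
      ≤ 2 * (2 * ξ' + 37 * ξ ^ 2 + 4 * a * ξ) := by
  have h := norm_hol_precomp_sub_hol_le hU X z κ ν hξ h1 h2 h3 h4 hP hc1 hc2
  set E := ((hol (fun y μ => expUnit (-(X y μ)) * U y μ) z (plaqWord κ ν) : (Matrix n n ℂ)ˣ) : Matrix n n ℂ)
  set P := ((hol U z (plaqWord κ ν) : (Matrix n n ℂ)ˣ) : Matrix n n ℂ)
  have hP2 : ‖P - 1‖ ≤ 1 / 2 := hP.trans (by linarith)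
  have hE2 : ‖E - 1‖ ≤ 1 / 2 :=
    calc ‖E - 1‖ ≤ ‖E - P‖ + ‖P - 1‖ := norm_sub_le_norm_sub_add_norm_sub _ _ _
      _ ≤ 1 / 4 + 1 / 4 := add_le_add (h.trans hsum) (hP.trans ha)
      _ = 1 / 2 := by norm_num
  calc ‖mlog E - mlog P‖ ≤ (1 + (1 / 2 : ℝ) / (1 - 1 / 2)) * ‖E - P‖ := norm_mlog_sub_mlog_le (by norm_num) hE2 hP2
    _ ≤ (1 + (1 / 2 : ℝ) / (1 - 1 / 2)) * (2 * ξ' + 37 * ξ ^ 2 + 4 * a * ξ) := by gcongr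
    _ = 2 * (2 * ξ' + 37 * ξ ^ 2 + 4 * a * ξ) := by norm_num

end

end Summit.QuantumFields.BalabanUV.T4Continuum.PrecompensatedPlaquette
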